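import Literature.Analysis.FluidPDE.LocalLerayCrossBulkLimits
import Literature.Analysis.FunctionSpaces.TimeDoublingCompact
import Literature.Analysis.FunctionSpaces.DuBoisReymondAE
import Mathlib.Analysis.SpecialFunctions.SmoothTransition
import HarnessLib

/-!
# The `u₁ · u₂` balance of two local Leray solutions (the cross identity)

Analysis/FluidPDE theorem file (no definitions). Weak–strong uniqueness for local Leray
solutions (Lemarié-Rieusset 2016, Thm. 14.7, proof p. 515) rests on three balances: the local
energy inequalities of `u₁` and of `u₂`, and the *identity* for `u₁ · u₂`. This file proves the
latter in tested, time-integrated form: for two local Leray solutions `(u₁,p₁)`, `(u₂,p₂)` on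
`(0,T) × ℝ³` with the same measurable datum `u₀`, weak gradients `G₁, G₂`, the first one regular
(`u₁ = u₃ + u₄`, `‖u₃(t)‖_∞ ≤ m(t)`, `m ∈ L²`, `‖u₄(t)‖_{L³} ≤ ε`), and every test function `ψ`,
for a.e. `t ∈ (0,T)`,
`∫ ψ ⟪u₁(t), u₂(t)⟫ = ∫ ψ |u₀|² + ∫₀ᵗ (f(s,s) + g(s,s)) ds`,
where `f(σ,s)` is the density of `u₁`'s equation at time `s` tested with `ψ u₂(σ)` and `g(s,σ)`
that of `u₂`'s equation at time `σ` tested with `ψ u₁(s)`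
(`IsLocalLeraySolutionOn.ae_pairing_smul_eq_datum_add`).

**Proof** (Serrin 1963, §4, for local Leray solutions). `Q(s,σ) = ∫ ψ ⟪u₁(s), u₂(σ)⟫` has the
two one-sided absolutely continuous representations furnished by the pairing identities, for
a.e. `σ` resp. a.e. `s`; the doubling identity `FunctionSpaces.doubling_identity_compact` with a
cut-off `χ ∈ C¹_c((0,T))` and kernels `ρₙ` gives
`∫∫ ρₙ χ' Q = -∫∫ ρₙ χ (f + g)`; as `n → ∞` the left side tends to `∫ χ' V`, `V(s) = Q(s,s)`
(an `L² × L²` doubled pairing) and the right side to `-∫ χ (f + g)` (`tendsto_cross_bulk`):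
`V' = f + g` in `𝒟'(0,T)` (`cross_distributional`). The initial layer — `V(s) → ∫ ψ|u₀|²` as
`s → 0⁺` essentially, from the `L²_loc` attainment of the datum — upgrades this to the test class
of the du Bois-Reymond lemma with initial datum (`cross_initial_layer`), and
`FunctionSpaces.ae_eq_add_setIntegral_of_forall_test` concludes (`ae_cross_pairing_eq`).

## References

* P. G. Lemarié-Rieusset, *The Navier–Stokes Problem in the 21st Century*, CRC Press 2016,
  doi:10.1201/b19556, Thm. 14.7, proof p. 515 (the balance of `u₁ · u₂`). [LemarieRieusset2016]
* J. Serrin, in: Nonlinear Problems (Madison 1962), 1963, §4. [Serrin1963]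
-/

noncomputable section

open MeasureTheory TopologicalSpace Set Function Filter Metric
open _root_.Topology
open scoped ENNReal NNReal RealInnerProductSpace

namespace Literature.Analysis.FluidPDE

open FunctionSpaces

section CrossIdentity

variable {T ν : ℝ} {u₀ : EuclideanSpace ℝ (Fin 3) → EuclideanSpace ℝ (Fin 3)}
  {u₁ u₂ u₃ u₄ : ℝ → EuclideanSpace ℝ (Fin 3) → EuclideanSpace ℝ (Fin 3)}
  {p₁ p₂ : ℝ → EuclideanSpace ℝ (Fin 3) → ℝ}
  {G₁ G₂ : ℝ → EuclideanSpace ℝ (Fin 3) → EuclideanSpace ℝ (Fin 3) →L[ℝ] EuclideanSpace ℝ (Fin 3)}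
  {m : ℝ → ℝ} {ε : ℝ} {ψ : EuclideanSpace ℝ (Fin 3) → ℝ}

/-! ## Good slices of a local Leray solution, as `H¹` test data on a ball -/

/-- For a.e. `σ`, the slice `u(σ)` of a local Leray solution with weak gradient `G` is admissible
test data on the ball `B(0,R)`: `G(σ)` is its weak derivative there, `u(σ) ∈ L⁶(B)`,
`G(σ) ∈ L²(B)`, and `tr G(σ) = 0` a.e. (the hypotheses of
`IsLocalLeraySolutionOn.ae_pairing_smul_eq_datum_add`). [folklore] -/
theorem IsLocalLeraySolutionOn.ae_slice_test_data {v₀ : EuclideanSpace ℝ (Fin 3) → EuclideanSpace ℝ (Fin 3)}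
    {v : ℝ → EuclideanSpace ℝ (Fin 3) → EuclideanSpace ℝ (Fin 3)} {π : ℝ → EuclideanSpace ℝ (Fin 3) → ℝ}
    {G : ℝ → EuclideanSpace ℝ (Fin 3) → EuclideanSpace ℝ (Fin 3) →L[ℝ] EuclideanSpace ℝ (Fin 3)}
    (h : IsLocalLeraySolutionOn T ν v₀ v π)
    (hG : HasWeakSpatialGradientOn (slab (EuclideanSpace ℝ (Fin 3)) (Ioo 0 T) isOpen_Ioo) v G)
    (R : ℝ) :
    ∀ᵐ σ ∂((volume : Measure ℝ).restrict (Ioo 0 T)),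
      HasWeakFDerivOn (⟨ball (0 : EuclideanSpace ℝ (Fin 3)) R, isOpen_ball⟩ :
        Opens (EuclideanSpace ℝ (Fin 3))) volume (v σ) (G σ) ∧
      ∫⁻ x in ball (0 : EuclideanSpace ℝ (Fin 3)) R, ‖v σ x‖ₑ ^ 6 < ∞ ∧
      ∫⁻ x in ball (0 : EuclideanSpace ℝ (Fin 3)) R, ‖G σ x‖ₑ ^ 2 < ∞ ∧
      ∀ᵐ x ∂(volume.restrict (ball (0 : EuclideanSpace ℝ (Fin 3)) R)),
        ∑ j, G σ x (EuclideanSpace.single j (1 : ℝ)) j = 0 := by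
  set n : ℕ := ⌈R⌉₊ with hn
  have hRn : R ≤ n := Nat.le_ceil R
  have hsix := h.lintegral_eLpNorm_slice_six_sq_lt_top hG (isCompact_closedBall (0 : EuclideanSpace ℝ (Fin 3)) R)
  have hsixae := ae_eLpNorm_slice_lt_top_of_rpow (μ := volume)
    (h.aestronglyMeasurable_prod_restrict (closedBall (0 : EuclideanSpace ℝ (Fin 3)) R)) 6 two_pos hsix.ne
  filter_upwards [hG.ae_hasWeakFDerivOn_slice_slab, hsixae, h.ae_lintegral_grad_sq_ball_lt_top hG,
    h.ae_trace_slice_eq_zero hG] with σ h1 h2 h3 h4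
  refine ⟨FunctionSpaces.HasWeakFDerivOn.mono_set_holds h1 le_top, ?_, ?_, ae_restrict_of_ae h4⟩
  · have h6 : (6 : ℝ≥0∞).toReal = 6 := by norm_num
    rw [eLpNorm_eq_lintegral_rpow_enorm_toReal (by norm_num) (by norm_num), h6] at h2
    have h2' : ∫⁻ x in closedBall (0 : EuclideanSpace ℝ (Fin 3)) R, ‖v σ x‖ₑ ^ (6 : ℝ) < ∞ := by
      by_contra hnot
      rw [not_lt, top_le_iff] at hnot
      rw [hnot, ENNReal.top_rpow_of_pos (by norm_num)] at h2
      exact lt_irrefl _ h2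
    refine lt_of_le_of_lt (lintegral_mono_set ball_subset_closedBall) ?_
    refine lt_of_le_of_lt (lintegral_mono fun x => le_of_eq ?_) h2'
    rw [← ENNReal.rpow_natCast]; norm_num
  · exact (lintegral_mono_set (ball_subset_ball hRn)).trans_lt (h3 n)

/-! ## The two one-sided representations of `Q(s,σ) = ∫ ψ ⟪u₁(s), u₂(σ)⟫` -/

/-- **The representation of `s ↦ Q(s,σ)` for a.e. `σ`** (equation of `u₁` tested with
`ψ u₂(σ)`): for a.e. `σ ∈ (0,T)` and then a.e. `s ∈ (0,T)`,
`∫ ⟪u₁(s), ψ u₂(σ)⟫ = ∫ ⟪u₀, ψ u₂(σ)⟫ + ∫_{(0,s]} f(σ,τ) dτ`. [cite: LemarieRieusset2016, Thm. 14.7 proof p. 515] -/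
theorem ae_ae_cross_rep_one
    (h₁ : IsLocalLeraySolutionOn T ν u₀ u₁ p₁) (h₂ : IsLocalLeraySolutionOn T ν u₀ u₂ p₂)
    (hG₁ : HasWeakSpatialGradientOn (slab (EuclideanSpace ℝ (Fin 3)) (Ioo 0 T) isOpen_Ioo) u₁ G₁)
    (hG₂ : HasWeakSpatialGradientOn (slab (EuclideanSpace ℝ (Fin 3)) (Ioo 0 T) isOpen_Ioo) u₂ G₂)
    (hψ : IsTestFunctionOn (⊤ : Opens (EuclideanSpace ℝ (Fin 3))) ψ)
    (hT : 0 < T) (hm₀ : AEStronglyMeasurable u₀ volume) :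
    ∀ᵐ σ ∂((volume : Measure ℝ).restrict (Ioo 0 T)), ∀ᵐ s ∂((volume : Measure ℝ).restrict (Ioo 0 T)),
      ∫ x, ⟪u₁ s x, ψ x • u₂ σ x⟫ = (∫ x, ⟪u₀ x, ψ x • u₂ σ x⟫) +
        ∫ τ in Ioc 0 s, (((-∫ x, ⟪G₁ τ x (u₁ τ x), ψ x • u₂ σ x⟫) + ∫ x, p₁ τ x * fderiv ℝ ψ x (u₂ σ x)) -
          ν * ∫ x, ∑ i, ⟪G₁ τ x (stdOrthonormalBasis ℝ (EuclideanSpace ℝ (Fin 3)) i),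
            fderiv ℝ ψ x (stdOrthonormalBasis ℝ (EuclideanSpace ℝ (Fin 3)) i) • u₂ σ x + ψ x • G₂ σ x (stdOrthonormalBasis ℝ (EuclideanSpace ℝ (Fin 3)) i)⟫) := by
  obtain ⟨R, hR, hKR⟩ := hψ.hasCompactSupport.isCompact.isBounded.subset_ball_lt 0 (0 : EuclideanSpace ℝ (Fin 3))
  have hψR : IsTestFunctionOn (⟨ball (0 : EuclideanSpace ℝ (Fin 3)) R, isOpen_ball⟩ :
      Opens (EuclideanSpace ℝ (Fin 3))) ψ := ⟨hψ.contDiff, hψ.hasCompactSupport, hKR⟩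
  filter_upwards [h₂.ae_slice_test_data hG₂ R] with σ hσ
  exact h₁.ae_pairing_smul_eq_datum_add hT hm₀ hG₁ hR hσ.1 hσ.2.1 hσ.2.2.1 hσ.2.2.2 hψR

/-- **The representation of `σ ↦ Q(s,σ)` for a.e. `s`** (equation of `u₂` tested with
`ψ u₁(s)`): for a.e. `s` and then a.e. `σ`,
`∫ ⟪u₁(s), ψ u₂(σ)⟫ = ∫ ⟪u₀, ψ u₁(s)⟫ + ∫_{(0,σ]} g(s,τ) dτ`. [cite: LemarieRieusset2016, Thm. 14.7 proof p. 515] -/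
theorem ae_ae_cross_rep_two
    (h₁ : IsLocalLeraySolutionOn T ν u₀ u₁ p₁) (h₂ : IsLocalLeraySolutionOn T ν u₀ u₂ p₂)
    (hG₁ : HasWeakSpatialGradientOn (slab (EuclideanSpace ℝ (Fin 3)) (Ioo 0 T) isOpen_Ioo) u₁ G₁)
    (hG₂ : HasWeakSpatialGradientOn (slab (EuclideanSpace ℝ (Fin 3)) (Ioo 0 T) isOpen_Ioo) u₂ G₂)
    (hψ : IsTestFunctionOn (⊤ : Opens (EuclideanSpace ℝ (Fin 3))) ψ)
    (hT : 0 < T) (hm₀ : AEStronglyMeasurable u₀ volume) :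
    ∀ᵐ s ∂((volume : Measure ℝ).restrict (Ioo 0 T)), ∀ᵐ σ ∂((volume : Measure ℝ).restrict (Ioo 0 T)),
      ∫ x, ⟪u₁ s x, ψ x • u₂ σ x⟫ = (∫ x, ⟪u₀ x, ψ x • u₁ s x⟫) +
        ∫ τ in Ioc 0 σ, (((-∫ x, ⟪G₂ τ x (u₂ τ x), ψ x • u₁ s x⟫) + ∫ x, p₂ τ x * fderiv ℝ ψ x (u₁ s x)) -
          ν * ∫ x, ∑ i, ⟪G₂ τ x (stdOrthonormalBasis ℝ (EuclideanSpace ℝ (Fin 3)) i),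
            fderiv ℝ ψ x (stdOrthonormalBasis ℝ (EuclideanSpace ℝ (Fin 3)) i) • u₁ s x + ψ x • G₁ s x (stdOrthonormalBasis ℝ (EuclideanSpace ℝ (Fin 3)) i)⟫) := by
  obtain ⟨R, hR, hKR⟩ := hψ.hasCompactSupport.isCompact.isBounded.subset_ball_lt 0 (0 : EuclideanSpace ℝ (Fin 3))
  have hψR : IsTestFunctionOn (⟨ball (0 : EuclideanSpace ℝ (Fin 3)) R, isOpen_ball⟩ :
      Opens (EuclideanSpace ℝ (Fin 3))) ψ := ⟨hψ.contDiff, hψ.hasCompactSupport, hKR⟩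
  filter_upwards [h₁.ae_slice_test_data hG₁ R] with s hs
  have h := h₂.ae_pairing_smul_eq_datum_add hT hm₀ hG₂ hR hs.1 hs.2.1 hs.2.2.1 hs.2.2.2 hψR
  filter_upwards [h] with σ hσ
  have hsym : ∫ x, ⟪u₁ s x, ψ x • u₂ σ x⟫ = ∫ x, ⟪u₂ σ x, ψ x • u₁ s x⟫ := by
    refine integral_congr_ae (Eventually.of_forall fun x => ?_)
    simp only
    rw [real_inner_smul_right, real_inner_smul_right, real_inner_comm]
  rw [hsym, hσ]

/-! ## The pairing `Q` and its diagonal `V` -/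

/-- `∫ ⟪A, ψ B⟫ = ∫_K ⟪ψ A, B⟫`, `K = supp ψ`. [folklore] -/
theorem integral_inner_smul_eq_setIntegral (A B : EuclideanSpace ℝ (Fin 3) → EuclideanSpace ℝ (Fin 3)) :
    ∫ x, ⟪A x, ψ x • B x⟫ = ∫ x in tsupport ψ, ⟪ψ x • A x, B x⟫ := by
  rw [← setIntegral_eq_integral_of_forall_compl_eq_zero (s := tsupport ψ)]
  · refine integral_congr_ae (Eventually.of_forall fun x => ?_)
    simp only
    rw [real_inner_smul_right, real_inner_smul_left]
  · intro x hx
    rw [image_eq_zero_of_notMem_tsupport hx, zero_smul, inner_zero_right]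

/-- `Q(s,σ) = ∫ ⟪u₁(s), ψ u₂(σ)⟫ = ∫_K ⟪ψ u₁(s), u₂(σ)⟫`, `K = supp ψ`. [folklore] -/
theorem cross_Q_eq_setIntegral (s σ : ℝ) :
    ∫ x, ⟪u₁ s x, ψ x • u₂ σ x⟫ = ∫ x in tsupport ψ, ⟪ψ x • u₁ s x, u₂ σ x⟫ :=
  integral_inner_smul_eq_setIntegral (ψ := ψ) (u₁ s) (u₂ σ)

/-- **Cauchy–Schwarz for the tested pairing on `K`**: for `L²(K)` fields `A, B` and `|ψ| ≤ C_ψ`,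
`x ↦ ⟪ψ A, B⟫` is integrable on `K` and `|∫_K ⟪ψ A, B⟫| ≤ C_ψ ‖A‖_{L²(K)} ‖B‖_{L²(K)}`. [folklore] -/
theorem integrable_inner_smul_and_abs_le {K : Set (EuclideanSpace ℝ (Fin 3))} (hψc : Continuous ψ) {Cψ : ℝ}
    (hψb : ∀ x, ‖ψ x‖ ≤ Cψ)
    {A B : EuclideanSpace ℝ (Fin 3) → EuclideanSpace ℝ (Fin 3)}
    (hA : AEStronglyMeasurable A (volume.restrict K)) (hB : AEStronglyMeasurable B (volume.restrict K))
    (hA2 : ∫⁻ x in K, ‖A x‖ₑ ^ 2 < ∞) (hB2 : ∫⁻ x in K, ‖B x‖ₑ ^ 2 < ∞) :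
    Integrable (fun x => ⟪ψ x • A x, B x⟫) (volume.restrict K) ∧
      |∫ x in K, ⟪ψ x • A x, B x⟫| ≤
        Cψ * ((∫⁻ x in K, ‖A x‖ₑ ^ 2) ^ (1 / 2 : ℝ) * (∫⁻ x in K, ‖B x‖ₑ ^ 2) ^ (1 / 2 : ℝ)).toReal := by
  have hCψ0 : 0 ≤ Cψ := (norm_nonneg _).trans (hψb 0)
  have hpt : ∀ x, ‖⟪ψ x • A x, B x⟫‖ ≤ Cψ * (‖A x‖ * ‖B x‖) := fun x => by
    calc ‖⟪ψ x • A x, B x⟫‖ ≤ ‖ψ x • A x‖ * ‖B x‖ := norm_inner_le_norm _ _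
      _ = ‖ψ x‖ * (‖A x‖ * ‖B x‖) := by rw [norm_smul, mul_assoc]
      _ ≤ Cψ * (‖A x‖ * ‖B x‖) := mul_le_mul_of_nonneg_right (hψb x) (by positivity)
  have hsq : ∀ {Cf : EuclideanSpace ℝ (Fin 3) → EuclideanSpace ℝ (Fin 3)}, AEStronglyMeasurable Cf (volume.restrict K) →
      ∫⁻ x in K, ‖Cf x‖ₑ ^ 2 < ∞ → Integrable (fun x => ‖Cf x‖ ^ 2) (volume.restrict K) := by
    intro Cf hm h2
    refine ⟨hm.norm.pow 2, ?_⟩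
    rw [hasFiniteIntegral_iff_enorm]
    refine lt_of_le_of_lt (lintegral_mono fun x => le_of_eq ?_) h2
    rw [Real.enorm_eq_ofReal (sq_nonneg _), ← ofReal_norm, ENNReal.ofReal_pow (norm_nonneg _)]
  have hprod := integrable_norm_mul_norm_of_sq hA hB (hsq hA hA2) (hsq hB hB2)
  have hint : Integrable (fun x => ⟪ψ x • A x, B x⟫) (volume.restrict K) :=
    Integrable.mono' (hprod.const_mul Cψ) ((hψc.aestronglyMeasurable.smul hA).inner hB) (Eventually.of_forall hpt)
  refine ⟨hint, ?_⟩
  calc |∫ x in K, ⟪ψ x • A x, B x⟫| ≤ ∫ x in K, ‖⟪ψ x • A x, B x⟫‖ := by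
        rw [← Real.norm_eq_abs]; exact norm_integral_le_integral_norm _
    _ ≤ ∫ x in K, Cψ * (‖A x‖ * ‖B x‖) :=
        integral_mono_of_nonneg (Eventually.of_forall fun x => norm_nonneg _) (hprod.const_mul Cψ)
          (Eventually.of_forall hpt)
    _ = Cψ * ∫ x in K, ‖A x‖ * ‖B x‖ := integral_const_mul _ _
    _ ≤ _ := mul_le_mul_of_nonneg_left (integral_norm_mul_norm_le_toReal hA hB hA2.ne hB2.ne) hCψ0

/-- The factor `ψ u₁` on the cylinder: a.e.-measurable with `∫ ‖ψ u₁(s)‖²_{L²(K)} ds < ∞`.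
[folklore] -/
theorem cross_factor_psi_u₁ (h₁ : IsLocalLeraySolutionOn T ν u₀ u₁ p₁)
    (hψ : IsTestFunctionOn (⊤ : Opens (EuclideanSpace ℝ (Fin 3))) ψ) :
    AEStronglyMeasurable (uncurry fun s x => ψ x • u₁ s x)
      (((volume : Measure ℝ).restrict (Ioo 0 T)).prod ((volume : Measure (EuclideanSpace ℝ (Fin 3))).restrict (tsupport ψ))) ∧
    ∫⁻ s, eLpNorm (fun x => ψ x • u₁ s x) 2 ((volume : Measure (EuclideanSpace ℝ (Fin 3))).restrict (tsupport ψ)) ^ (2 : ℝ)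
      ∂((volume : Measure ℝ).restrict (Ioo 0 T)) ≠ ∞ := by
  obtain ⟨hK, hψc, -, ⟨Cψ, -, hψb, -⟩, -, -⟩ := testFunction_facts hψ
  have hu₁m := h₁.aestronglyMeasurable_prod_restrict (tsupport ψ)
  refine ⟨(hψc.comp continuous_snd).aestronglyMeasurable.smul hu₁m, ?_⟩
  exact lintegral_rpow_ne_top_of_le_const_mul ENNReal.ofReal_ne_top
    (fun s => eLpNorm_smul_le_of_norm_le hψb _ 2) (by norm_num) (h₁.lintegral_eLpNorm_slice_two_lt_top hK).ne

/-- **`Q` is integrable on `(0,T)²`** (`L² × L²` slices). [folklore] -/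
theorem integrable_cross_Q (h₁ : IsLocalLeraySolutionOn T ν u₀ u₁ p₁) (h₂ : IsLocalLeraySolutionOn T ν u₀ u₂ p₂)
    (hψ : IsTestFunctionOn (⊤ : Opens (EuclideanSpace ℝ (Fin 3))) ψ) :
    Integrable (fun p : ℝ × ℝ => ∫ x, ⟪u₁ p.2 x, ψ x • u₂ p.1 x⟫)
      (((volume : Measure ℝ).restrict (Ioo 0 T)).prod ((volume : Measure ℝ).restrict (Ioo 0 T))) := by
  obtain ⟨hK, -, -, -, -, -⟩ := testFunction_facts hψ
  obtain ⟨ha, haN⟩ := cross_factor_psi_u₁ (T := T) h₁ hψ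
  have hu₂m := h₂.aestronglyMeasurable_prod_restrict (tsupport ψ)
  have heq : (fun p : ℝ × ℝ => ∫ x, ⟪u₁ p.2 x, ψ x • u₂ p.1 x⟫) =
      fun p => ∫ x in tsupport ψ, ⟪ψ x • u₁ p.2 x, u₂ p.1 x⟫ := funext fun p => cross_Q_eq_setIntegral _ _
  rw [heq]
  exact integrable_integral_inner_prod (μ := volume) ha hu₂m 2 2
    (lintegral_eLpNorm_slice_ne_top_of_rpow ha 2 one_le_two haN)
    (lintegral_eLpNorm_slice_ne_top_of_rpow hu₂m 2 one_le_two (h₂.lintegral_eLpNorm_slice_two_lt_top hK).ne)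

/-- **The diagonal `V(s) = ∫ ⟪u₁(s), ψ u₂(s)⟫` is integrable on `(0,T)`.** [folklore] -/
theorem integrable_cross_V (h₁ : IsLocalLeraySolutionOn T ν u₀ u₁ p₁) (h₂ : IsLocalLeraySolutionOn T ν u₀ u₂ p₂)
    (hψ : IsTestFunctionOn (⊤ : Opens (EuclideanSpace ℝ (Fin 3))) ψ) :
    Integrable (fun s => ∫ x, ⟪u₁ s x, ψ x • u₂ s x⟫) ((volume : Measure ℝ).restrict (Ioo 0 T)) := by
  obtain ⟨hK, -, -, -, -, -⟩ := testFunction_facts hψ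
  obtain ⟨ha, haN⟩ := cross_factor_psi_u₁ (T := T) h₁ hψ
  have hu₂m := h₂.aestronglyMeasurable_prod_restrict (tsupport ψ)
  have h := (integrable_inner_diag_of_rpow (μ := volume) ha hu₂m Real.HolderConjugate.two_two 2 2 haN
    (h₂.lintegral_eLpNorm_slice_two_lt_top hK).ne).integral_prod_left
  refine h.congr (Eventually.of_forall fun s => ?_)
  exact (cross_Q_eq_setIntegral s s).symm

/-! ## `V' = f + g` in `𝒟'(0,T)` -/

set_option maxHeartbeats 1600000 in
/-- **The balance of `u₁ · u₂` in the sense of distributions on `(0,T)`.** For every `C¹`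
cut-off `χ` with `tsupport χ ⊆ [δ, T-δ]`, `δ > 0`,
`∫ χ'(s) V(s) ds + ∫ χ(s) (f(s,s) + g(s,s)) ds = 0`, `V(s) = ∫ ψ ⟪u₁(s), u₂(s)⟫`
(doubling of the time variable, `FunctionSpaces.doubling_identity_compact`, and the limits
`tendsto_cross_bulk` and `FunctionSpaces.doubledPairing_package_of_rpow`; Serrin 1963, §4;
Lemarié-Rieusset 2016, Thm. 14.7, proof p. 515). [cite: LemarieRieusset2016, Thm. 14.7 proof p. 515] -/
theorem cross_distributional
    (h₁ : IsLocalLeraySolutionOn T ν u₀ u₁ p₁) (h₂ : IsLocalLeraySolutionOn T ν u₀ u₂ p₂)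
    (hG₁ : HasWeakSpatialGradientOn (slab (EuclideanSpace ℝ (Fin 3)) (Ioo 0 T) isOpen_Ioo) u₁ G₁)
    (hG₂ : HasWeakSpatialGradientOn (slab (EuclideanSpace ℝ (Fin 3)) (Ioo 0 T) isOpen_Ioo) u₂ G₂)
    (hψ : IsTestFunctionOn (⊤ : Opens (EuclideanSpace ℝ (Fin 3))) ψ)
    (hu₃ : AEStronglyMeasurable (uncurry u₃)
      ((volume : Measure (ℝ × EuclideanSpace ℝ (Fin 3))).restrict (Ioo 0 T ×ˢ univ)))
    (hsplit : uncurry u₁ =ᵐ[(volume : Measure (ℝ × EuclideanSpace ℝ (Fin 3))).restrict (Ioo 0 T ×ˢ univ)]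
      fun z => u₃ z.1 z.2 + u₄ z.1 z.2)
    (hm : ∀ᵐ t ∂((volume : Measure ℝ).restrict (Ioo 0 T)), eLpNorm (u₃ t) ∞ volume ≤ ENNReal.ofReal (m t))
    (hm2 : IntegrableOn (fun t => m t ^ 2) (Ioo 0 T) volume)
    (hε : ∀ᵐ t ∂((volume : Measure ℝ).restrict (Ioo 0 T)), eLpNorm (u₄ t) 3 volume ≤ ENNReal.ofReal ε)
    (hT : 0 < T) (hm₀ : AEStronglyMeasurable u₀ volume)
    {χ : ℝ → ℝ} (hχ : ContDiff ℝ 1 χ) {δ : ℝ} (hδ : 0 < δ) (hχs : tsupport χ ⊆ Icc δ (T - δ)) :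
    (∫ s in Ioo 0 T, deriv χ s * ∫ x, ⟪u₁ s x, ψ x • u₂ s x⟫) +
      ∫ s in Ioo 0 T, χ s *
        ((((-∫ x, ⟪G₁ s x (u₁ s x), ψ x • u₂ s x⟫) + ∫ x, p₁ s x * fderiv ℝ ψ x (u₂ s x)) -
          ν * ∫ x, ∑ i, ⟪G₁ s x (stdOrthonormalBasis ℝ (EuclideanSpace ℝ (Fin 3)) i),
            fderiv ℝ ψ x (stdOrthonormalBasis ℝ (EuclideanSpace ℝ (Fin 3)) i) • u₂ s x + ψ x • G₂ s x (stdOrthonormalBasis ℝ (EuclideanSpace ℝ (Fin 3)) i)⟫) +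
         (((-∫ x, ⟪G₂ s x (u₂ s x), ψ x • u₁ s x⟫) + ∫ x, p₂ s x * fderiv ℝ ψ x (u₁ s x)) -
          ν * ∫ x, ∑ i, ⟪G₂ s x (stdOrthonormalBasis ℝ (EuclideanSpace ℝ (Fin 3)) i),
            fderiv ℝ ψ x (stdOrthonormalBasis ℝ (EuclideanSpace ℝ (Fin 3)) i) • u₁ s x + ψ x • G₁ s x (stdOrthonormalBasis ℝ (EuclideanSpace ℝ (Fin 3)) i)⟫)) = 0 := by
  obtain ⟨hK, hψc, hgc, ⟨Cψ, hCψ0, hψb, hgb⟩, hψ0, hg0⟩ := testFunction_facts hψ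
  set K : Set (EuclideanSpace ℝ (Fin 3)) := tsupport ψ with hKdef
  set μI : Measure ℝ := volume.restrict (Ioo 0 T) with hμI
  set μK : Measure (EuclideanSpace ℝ (Fin 3)) := volume.restrict K with hμK
  -- the cut-off
  have hχK : HasCompactSupport χ := isCompact_Icc.of_isClosed_subset (isClosed_tsupport _) hχs
  have hχc : Continuous χ := hχ.continuous
  have hχ'c : Continuous (deriv χ) := hχ.continuous_deriv le_rfl
  obtain ⟨Cχ, hCχ⟩ := hχc.bounded_above_of_compact_support hχK
  obtain ⟨Cχ', hCχ'⟩ := hχ'c.bounded_above_of_compact_support hχK.deriv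
  have hχ0 : ∀ s, s ∉ Icc δ (T - δ) → χ s = 0 := fun s hs =>
    image_eq_zero_of_notMem_tsupport fun h => hs (hχs h)
  have hχ'0 : ∀ s, s ∉ Icc δ (T - δ) → deriv χ s = 0 := fun s hs => by
    rw [← fderiv_apply_one_eq_deriv, fderiv_of_notMem_tsupport ℝ (fun h => hs (hχs h))]
    rfl
  -- kernels
  obtain ⟨φ, hφ, -⟩ := FunctionSpaces.exists_contDiffBump_seq (E := ℝ)
  -- the fields
  have hu₁m := h₁.aestronglyMeasurable_prod_restrict K
  have hu₂m := h₂.aestronglyMeasurable_prod_restrict K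
  have hbi_u2 := h₂.integrable_prod_restrict hK
  have h22 := (h₂.lintegral_eLpNorm_slice_two_lt_top hK).ne
  -- the left factor `χ' ψ u₁`
  have haV : AEStronglyMeasurable (uncurry fun s x => (deriv χ s * ψ x) • u₁ s x) (μI.prod μK) :=
    ((hχ'c.comp continuous_fst).mul (hψc.comp continuous_snd)).aestronglyMeasurable.smul hu₁m
  have haSV : ∀ s, s ∉ Icc δ (T - δ) → (fun x => (deriv χ s * ψ x) • u₁ s x) = 0 := fun s hs => by
    funext x; simp [hχ'0 s hs]
  have hCχ'0 : 0 ≤ Cχ' := (norm_nonneg _).trans (hCχ' 0)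
  have haNV : ∫⁻ s, eLpNorm (fun x => (deriv χ s * ψ x) • u₁ s x) 2 μK ^ (2 : ℝ) ∂μI ≠ ∞ :=
    lintegral_rpow_ne_top_of_le_const_mul ENNReal.ofReal_ne_top
      (fun s => eLpNorm_smul_le_of_norm_le (C := Cχ' * Cψ) (fun x => by
        rw [norm_mul]; exact mul_le_mul (hCχ' s) (hψb x) (norm_nonneg _) hCχ'0) _ 2)
      (by norm_num) (h₁.lintegral_eLpNorm_slice_two_lt_top hK).ne
  have PV := doubledPairing_package_of_rpow (μ := volume) hφ hδ hK haV haSV hu₂m hbi_u2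
    Real.HolderConjugate.two_two 2 2 (by norm_num) haNV h22
  -- the bulk limit
  have hbulk := tendsto_cross_bulk h₁ h₂ hG₁ hG₂ hψ hu₃ hsplit hm hm2 hε hχc hCχ hδ hχ0 hφ
  -- the doubling identity
  have hQi := integrable_cross_Q (T := T) h₁ h₂ hψ
  obtain ⟨hfi, hgi, -, -⟩ := integrable_cross_densities h₁ h₂ hG₁ hG₂ hψ hu₃ hsplit hm hm2 hε
  have hA : ∀ᵐ σ ∂μI, IntegrableOn (fun s => ((-∫ x, ⟪G₁ s x (u₁ s x), ψ x • u₂ σ x⟫) + ∫ x, p₁ s x * fderiv ℝ ψ x (u₂ σ x)) -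
          ν * ∫ x, ∑ i, ⟪G₁ s x (stdOrthonormalBasis ℝ (EuclideanSpace ℝ (Fin 3)) i),
            fderiv ℝ ψ x (stdOrthonormalBasis ℝ (EuclideanSpace ℝ (Fin 3)) i) • u₂ σ x + ψ x • G₂ σ x (stdOrthonormalBasis ℝ (EuclideanSpace ℝ (Fin 3)) i)⟫) (Ioo 0 T) volume ∧
      ∀ᵐ s ∂μI, ∫ x, ⟪u₁ s x, ψ x • u₂ σ x⟫ = (∫ x, ⟪u₀ x, ψ x • u₂ σ x⟫) +
        ∫ τ in Ioc 0 s, (((-∫ x, ⟪G₁ τ x (u₁ τ x), ψ x • u₂ σ x⟫) + ∫ x, p₁ τ x * fderiv ℝ ψ x (u₂ σ x)) -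
          ν * ∫ x, ∑ i, ⟪G₁ τ x (stdOrthonormalBasis ℝ (EuclideanSpace ℝ (Fin 3)) i),
            fderiv ℝ ψ x (stdOrthonormalBasis ℝ (EuclideanSpace ℝ (Fin 3)) i) • u₂ σ x + ψ x • G₂ σ x (stdOrthonormalBasis ℝ (EuclideanSpace ℝ (Fin 3)) i)⟫) := by
    filter_upwards [hfi.prod_right_ae, ae_ae_cross_rep_one h₁ h₂ hG₁ hG₂ hψ hT hm₀] with σ i1 i2
    exact ⟨i1, i2⟩
  have hB : ∀ᵐ s ∂μI, IntegrableOn (fun σ => ((-∫ x, ⟪G₂ σ x (u₂ σ x), ψ x • u₁ s x⟫) + ∫ x, p₂ σ x * fderiv ℝ ψ x (u₁ s x)) -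
          ν * ∫ x, ∑ i, ⟪G₂ σ x (stdOrthonormalBasis ℝ (EuclideanSpace ℝ (Fin 3)) i),
            fderiv ℝ ψ x (stdOrthonormalBasis ℝ (EuclideanSpace ℝ (Fin 3)) i) • u₁ s x + ψ x • G₁ s x (stdOrthonormalBasis ℝ (EuclideanSpace ℝ (Fin 3)) i)⟫) (Ioo 0 T) volume ∧
      ∀ᵐ σ ∂μI, ∫ x, ⟪u₁ s x, ψ x • u₂ σ x⟫ = (∫ x, ⟪u₀ x, ψ x • u₁ s x⟫) +
        ∫ τ in Ioc 0 σ, (((-∫ x, ⟪G₂ τ x (u₂ τ x), ψ x • u₁ s x⟫) + ∫ x, p₂ τ x * fderiv ℝ ψ x (u₁ s x)) -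
          ν * ∫ x, ∑ i, ⟪G₂ τ x (stdOrthonormalBasis ℝ (EuclideanSpace ℝ (Fin 3)) i),
            fderiv ℝ ψ x (stdOrthonormalBasis ℝ (EuclideanSpace ℝ (Fin 3)) i) • u₁ s x + ψ x • G₁ s x (stdOrthonormalBasis ℝ (EuclideanSpace ℝ (Fin 3)) i)⟫) := by
    filter_upwards [hgi.prod_left_ae, ae_ae_cross_rep_two h₁ h₂ hG₁ hG₂ hψ hT hm₀] with s i1 i2
    exact ⟨i1, i2⟩
  have hdoub : ∀ n, (φ n).rOut < δ →
      ∫ p, (φ n).normed volume (p.2 - p.1) * deriv χ p.2 * (∫ x, ⟪u₁ p.2 x, ψ x • u₂ p.1 x⟫) ∂(μI.prod μI) =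
      -∫ p, (φ n).normed volume (p.2 - p.1) * χ p.2 *
        ((((-∫ x, ⟪G₁ p.2 x (u₁ p.2 x), ψ x • u₂ p.1 x⟫) + ∫ x, p₁ p.2 x * fderiv ℝ ψ x (u₂ p.1 x)) -
          ν * ∫ x, ∑ i, ⟪G₁ p.2 x (stdOrthonormalBasis ℝ (EuclideanSpace ℝ (Fin 3)) i),
            fderiv ℝ ψ x (stdOrthonormalBasis ℝ (EuclideanSpace ℝ (Fin 3)) i) • u₂ p.1 x + ψ x • G₂ p.1 x (stdOrthonormalBasis ℝ (EuclideanSpace ℝ (Fin 3)) i)⟫) +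
         (((-∫ x, ⟪G₂ p.1 x (u₂ p.1 x), ψ x • u₁ p.2 x⟫) + ∫ x, p₂ p.1 x * fderiv ℝ ψ x (u₁ p.2 x)) -
          ν * ∫ x, ∑ i, ⟪G₂ p.1 x (stdOrthonormalBasis ℝ (EuclideanSpace ℝ (Fin 3)) i),
            fderiv ℝ ψ x (stdOrthonormalBasis ℝ (EuclideanSpace ℝ (Fin 3)) i) • u₁ p.2 x + ψ x • G₁ p.2 x (stdOrthonormalBasis ℝ (EuclideanSpace ℝ (Fin 3)) i)⟫)) ∂(μI.prod μI) := fun n hn =>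
    doubling_identity_compact (Q := fun s σ => ∫ x, ⟪u₁ s x, ψ x • u₂ σ x⟫) hT hQi hA hB hfi hgi hχ hχs (φ n) hn
  -- the left side is the doubled pairing of `χ' ψ u₁` with `u₂`
  have hpt : ∀ (c : ℝ) (s σ : ℝ), c * ∫ x, ⟪u₁ s x, ψ x • u₂ σ x⟫ = ∫ x in K, ⟪(c * ψ x) • u₁ s x, u₂ σ x⟫ := by
    intro c s σ
    rw [cross_Q_eq_setIntegral, const_mul_integral_inner]
    refine integral_congr_ae (Eventually.of_forall fun x => ?_)
    simp only [smul_smul]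
  have hL : ∀ n, ∫ p, (φ n).normed volume (p.2 - p.1) * deriv χ p.2 * (∫ x, ⟪u₁ p.2 x, ψ x • u₂ p.1 x⟫) ∂(μI.prod μI) =
      ∫ pr, (φ n).normed volume (pr.2 - pr.1) * ∫ x, ⟪(deriv χ pr.2 * ψ x) • u₁ pr.2 x, u₂ pr.1 x⟫ ∂μK ∂(μI.prod μI) :=
    fun n => integral_congr_ae (Eventually.of_forall fun p => by simp only; rw [mul_assoc, hpt])
  have hEq : ∀ᶠ n in atTop,
      (∫ pr, (φ n).normed volume (pr.2 - pr.1) * ∫ x, ⟪(deriv χ pr.2 * ψ x) • u₁ pr.2 x, u₂ pr.1 x⟫ ∂μK ∂(μI.prod μI)) =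
      -∫ p, (φ n).normed volume (p.2 - p.1) * χ p.2 *
        ((((-∫ x, ⟪G₁ p.2 x (u₁ p.2 x), ψ x • u₂ p.1 x⟫) + ∫ x, p₁ p.2 x * fderiv ℝ ψ x (u₂ p.1 x)) -
          ν * ∫ x, ∑ i, ⟪G₁ p.2 x (stdOrthonormalBasis ℝ (EuclideanSpace ℝ (Fin 3)) i),
            fderiv ℝ ψ x (stdOrthonormalBasis ℝ (EuclideanSpace ℝ (Fin 3)) i) • u₂ p.1 x + ψ x • G₂ p.1 x (stdOrthonormalBasis ℝ (EuclideanSpace ℝ (Fin 3)) i)⟫) +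
         (((-∫ x, ⟪G₂ p.1 x (u₂ p.1 x), ψ x • u₁ p.2 x⟫) + ∫ x, p₂ p.1 x * fderiv ℝ ψ x (u₁ p.2 x)) -
          ν * ∫ x, ∑ i, ⟪G₂ p.1 x (stdOrthonormalBasis ℝ (EuclideanSpace ℝ (Fin 3)) i),
            fderiv ℝ ψ x (stdOrthonormalBasis ℝ (EuclideanSpace ℝ (Fin 3)) i) • u₁ p.2 x + ψ x • G₁ p.2 x (stdOrthonormalBasis ℝ (EuclideanSpace ℝ (Fin 3)) i)⟫)) ∂(μI.prod μI) := by
    filter_upwards [(tendsto_order.1 hφ).2 _ hδ] with n hn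
    rw [← hL n, hdoub n hn]
  have hDV := tendsto_nhds_unique_of_eventuallyEq PV.1 hbulk.neg hEq
  -- the diagonal value of the left pairing
  have hDV' : (∫ z, ⟪(deriv χ z.1 * ψ z.2) • u₁ z.1 z.2, u₂ z.1 z.2⟫ ∂(μI.prod μK)) =
      ∫ s in Ioo 0 T, deriv χ s * ∫ x, ⟪u₁ s x, ψ x • u₂ s x⟫ := by
    rw [integral_prod _ PV.2.2.1]
    refine integral_congr_ae (Eventually.of_forall fun s => ?_)
    simp only
    exact (hpt _ _ _).symm
  rw [← hDV', hDV, neg_add_cancel]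

/-! ## The initial layer -/

/-- **Good `L²(K)` slices of a local Leray solution.** [folklore] -/
theorem IsLocalLeraySolutionOn.ae_slice_sq_lt_top {v₀ : EuclideanSpace ℝ (Fin 3) → EuclideanSpace ℝ (Fin 3)}
    {v : ℝ → EuclideanSpace ℝ (Fin 3) → EuclideanSpace ℝ (Fin 3)} {π : ℝ → EuclideanSpace ℝ (Fin 3) → ℝ}
    (h : IsLocalLeraySolutionOn T ν v₀ v π) {K : Set (EuclideanSpace ℝ (Fin 3))} (hK : IsCompact K) :
    ∀ᵐ t ∂((volume : Measure ℝ).restrict (Ioo 0 T)),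
      AEStronglyMeasurable (v t) (volume : Measure (EuclideanSpace ℝ (Fin 3))) ∧ ∫⁻ x in K, ‖v t x‖ₑ ^ 2 < ∞ := by
  obtain ⟨r, -, hKr⟩ := hK.isBounded.subset_ball_lt 0 (0 : EuclideanSpace ℝ (Fin 3))
  have hmeas : AEStronglyMeasurable (uncurry v)
      ((volume : Measure (ℝ × EuclideanSpace ℝ (Fin 3))).restrict (Ioo 0 T ×ˢ univ)) := h.aestronglyMeasurable
  have hsq : ∀ K' : Set (EuclideanSpace ℝ (Fin 3)), IsCompact K' →
      ∫⁻ z in Ioo 0 T ×ˢ K', ‖uncurry v z‖ₑ ^ 2 < ∞ := fun K' hK' => h.sqIntegrable K' hK'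
  filter_upwards [ae_slice_aestronglyMeasurable_and_lintegral_ball_lt_top hmeas hsq] with t ht
  refine ⟨ht.1, lt_of_le_of_lt (lintegral_mono_set (hKr.trans ((ball_subset_ball (Nat.le_ceil r)).trans
    ball_subset_closedBall))) (ht.2 ⌈r⌉₊)⟩

/-- **The initial layer of the `u₁ · u₂` balance**: `V(s) = ∫ ψ ⟪u₁(s), u₂(s)⟫ → ∫ ψ |u₀|²` as
`s → 0⁺`, essentially: for every `ε₁ > 0` there is `s₀ > 0` with `|V(s) - ∫ ψ|u₀|²| ≤ ε₁` for
a.e. `s ∈ (0, s₀)` (the `L²_loc` attainment of the common datum, clause (3) of the definition of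
local Leray solutions, and Cauchy–Schwarz). [cite: LemarieRieusset2016, Def. 14.1 p. 487] -/
theorem cross_initial_layer (h₁ : IsLocalLeraySolutionOn T ν u₀ u₁ p₁) (h₂ : IsLocalLeraySolutionOn T ν u₀ u₂ p₂)
    (hψ : IsTestFunctionOn (⊤ : Opens (EuclideanSpace ℝ (Fin 3))) ψ)
    (hT : 0 < T) (hm₀ : AEStronglyMeasurable u₀ volume) {ε₁ : ℝ} (hε₁ : 0 < ε₁) :
    ∃ s₀ > 0, ∀ᵐ s ∂((volume : Measure ℝ).restrict (Ioo 0 T)), s < s₀ →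
      |(∫ x, ⟪u₁ s x, ψ x • u₂ s x⟫) - ∫ x, ⟪u₀ x, ψ x • u₀ x⟫| ≤ ε₁ := by
  obtain ⟨hK, hψc, -, ⟨Cψ, hCψ0, hψb, -⟩, -, -⟩ := testFunction_facts hψ
  set K : Set (EuclideanSpace ℝ (Fin 3)) := tsupport ψ with hKdef
  have hgood₁ := h₁.ae_slice_sq_lt_top hK
  have hgood₂ := h₂.ae_slice_sq_lt_top hK
  obtain ⟨Cb, hCb, hbB⟩ := h₂.exists_ae_eLpNorm_slice_two_le hK
  have hU0 : ∫⁻ x in K, ‖u₀ x‖ₑ ^ 2 < ∞ := lintegral_datum_sq_lt_top hT hgood₁ hm₀ (h₁.initial K hK)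
  have hm₀K : AEStronglyMeasurable u₀ (volume.restrict K) := hm₀.restrict
  -- the bound and its limit at `0⁺`
  have hA₁ := h₁.initial K hK
  have hA₂ := h₂.initial K hK
  have hlim : Tendsto (fun s => Cψ * ((∫⁻ x in K, ‖u₁ s x - u₀ x‖ₑ ^ 2) ^ (1 / 2 : ℝ) * Cb +
      (∫⁻ x in K, ‖u₀ x‖ₑ ^ 2) ^ (1 / 2 : ℝ) * (∫⁻ x in K, ‖u₂ s x - u₀ x‖ₑ ^ 2) ^ (1 / 2 : ℝ)).toReal)
      (𝓝[>] 0) (𝓝 0) := by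
    have hr : Tendsto (fun y : ℝ≥0∞ => y ^ (1 / 2 : ℝ)) (𝓝 0) (𝓝 0) := by
      have := (ENNReal.continuous_rpow_const (y := 1 / 2)).tendsto 0
      rwa [ENNReal.zero_rpow_of_pos (by norm_num)] at this
    have h1 := hr.comp hA₁
    have h2 := hr.comp hA₂
    have h3 := (ENNReal.Tendsto.mul_const h1 (Or.inr hCb)).add
      (ENNReal.Tendsto.const_mul h2 (Or.inr (ENNReal.rpow_ne_top_of_nonneg (y := 1 / 2) (by norm_num) hU0.ne)))
    rw [zero_mul, mul_zero, add_zero] at h3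
    have h4 := ((ENNReal.tendsto_toReal ENNReal.zero_ne_top).comp h3).const_mul Cψ
    rw [ENNReal.toReal_zero, mul_zero] at h4
    exact h4
  have hev : ∀ᶠ s in 𝓝[>] (0 : ℝ), Cψ * ((∫⁻ x in K, ‖u₁ s x - u₀ x‖ₑ ^ 2) ^ (1 / 2 : ℝ) * Cb +
      (∫⁻ x in K, ‖u₀ x‖ₑ ^ 2) ^ (1 / 2 : ℝ) * (∫⁻ x in K, ‖u₂ s x - u₀ x‖ₑ ^ 2) ^ (1 / 2 : ℝ)).toReal < ε₁ :=
    hlim (Iio_mem_nhds hε₁)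
  obtain ⟨s₀, hs₀, hsub⟩ := mem_nhdsGT_iff_exists_Ioo_subset.1 hev
  refine ⟨s₀, hs₀, ?_⟩
  filter_upwards [hgood₁, hgood₂, hbB, ae_restrict_mem measurableSet_Ioo] with s g1 g2 hb hsI hs0
  have hbs := hsub ⟨hsI.1, hs0⟩
  refine le_trans ?_ hbs.le
  -- Cauchy–Schwarz
  have g1K : AEStronglyMeasurable (u₁ s) (volume.restrict K) := g1.1.restrict
  have g2K : AEStronglyMeasurable (u₂ s) (volume.restrict K) := g2.1.restrict
  have hsub_sq : ∀ {A B : EuclideanSpace ℝ (Fin 3) → EuclideanSpace ℝ (Fin 3)},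
      AEStronglyMeasurable A (volume.restrict K) → AEStronglyMeasurable B (volume.restrict K) →
      ∫⁻ x in K, ‖A x‖ₑ ^ 2 < ∞ → ∫⁻ x in K, ‖B x‖ₑ ^ 2 < ∞ → ∫⁻ x in K, ‖A x - B x‖ₑ ^ 2 < ∞ := by
    intro A B hAm hBm hA hB
    have hpt : ∀ x, ‖A x - B x‖ₑ ^ 2 ≤ 4 * (‖A x‖ₑ ^ 2 + ‖B x‖ₑ ^ 2) := fun x => by
      have h1 : ‖A x - B x‖ₑ ≤ ‖A x‖ₑ + ‖B x‖ₑ := enorm_sub_le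
      calc ‖A x - B x‖ₑ ^ 2 ≤ (‖A x‖ₑ + ‖B x‖ₑ) ^ 2 := pow_le_pow_left' h1 2
        _ ≤ 4 * (‖A x‖ₑ ^ 2 + ‖B x‖ₑ ^ 2) := by
            have := ennreal_add_rpow_two_le ‖A x‖ₑ ‖B x‖ₑ
            simpa only [ENNReal.rpow_two] using this
    calc ∫⁻ x in K, ‖A x - B x‖ₑ ^ 2 ≤ ∫⁻ x in K, 4 * (‖A x‖ₑ ^ 2 + ‖B x‖ₑ ^ 2) := lintegral_mono hpt
      _ = 4 * ((∫⁻ x in K, ‖A x‖ₑ ^ 2) + ∫⁻ x in K, ‖B x‖ₑ ^ 2) := by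
          rw [lintegral_const_mul' _ _ (by norm_num), lintegral_add_left' (hAm.enorm.pow_const _)]
      _ < ∞ := ENNReal.mul_lt_top (by norm_num) (ENNReal.add_lt_top.2 ⟨hA, hB⟩)
  have hd1 := hsub_sq g1K hm₀K g1.2 hU0
  have hd2 := hsub_sq g2K hm₀K g2.2 hU0
  obtain ⟨I₁, -⟩ := integrable_inner_smul_and_abs_le hψc hψb g1K g2K g1.2 g2.2
  obtain ⟨I₀, -⟩ := integrable_inner_smul_and_abs_le hψc hψb hm₀K hm₀K hU0 hU0
  have hA1m : AEStronglyMeasurable (fun x => u₁ s x - u₀ x) (volume.restrict K) := g1K.sub hm₀K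
  have hA2m : AEStronglyMeasurable (fun x => u₂ s x - u₀ x) (volume.restrict K) := g2K.sub hm₀K
  obtain ⟨IP, hP⟩ := integrable_inner_smul_and_abs_le hψc hψb hA1m g2K hd1 g2.2
  obtain ⟨IR, hR⟩ := integrable_inner_smul_and_abs_le hψc hψb hm₀K hA2m hU0 hd2
  have hdiff : (∫ x, ⟪u₁ s x, ψ x • u₂ s x⟫) - ∫ x, ⟪u₀ x, ψ x • u₀ x⟫ =
      (∫ x in K, ⟪ψ x • (u₁ s x - u₀ x), u₂ s x⟫) + ∫ x in K, ⟪ψ x • u₀ x, u₂ s x - u₀ x⟫ := by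
    rw [integral_inner_smul_eq_setIntegral, integral_inner_smul_eq_setIntegral, ← integral_sub I₁ I₀,
      ← integral_add IP IR]
    refine integral_congr_ae (Eventually.of_forall fun x => ?_)
    simp only [smul_sub, inner_sub_left, inner_sub_right]
    ring
  -- the `L²(K)` norm of `u₂(s)`
  have hb2 : (∫⁻ x in K, ‖u₂ s x‖ₑ ^ 2) ^ (1 / 2 : ℝ) ≤ Cb := by
    have h := hb
    rw [eLpNorm_eq_lintegral_rpow_enorm_toReal two_ne_zero ENNReal.ofNat_ne_top, ENNReal.toReal_ofNat] at h
    simpa only [ENNReal.rpow_two] using h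
  have hfinA1 : (∫⁻ x in K, ‖u₁ s x - u₀ x‖ₑ ^ 2) ^ (1 / 2 : ℝ) ≠ ∞ :=
    ENNReal.rpow_ne_top_of_nonneg (by norm_num) hd1.ne
  have hfinA2 : (∫⁻ x in K, ‖u₂ s x - u₀ x‖ₑ ^ 2) ^ (1 / 2 : ℝ) ≠ ∞ :=
    ENNReal.rpow_ne_top_of_nonneg (by norm_num) hd2.ne
  have hfinU0 : (∫⁻ x in K, ‖u₀ x‖ₑ ^ 2) ^ (1 / 2 : ℝ) ≠ ∞ :=
    ENNReal.rpow_ne_top_of_nonneg (by norm_num) hU0.ne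
  have hfinB : (∫⁻ x in K, ‖u₂ s x‖ₑ ^ 2) ^ (1 / 2 : ℝ) ≠ ∞ :=
    ENNReal.rpow_ne_top_of_nonneg (by norm_num) g2.2.ne
  rw [hdiff]
  calc |(∫ x in K, ⟪ψ x • (u₁ s x - u₀ x), u₂ s x⟫) + ∫ x in K, ⟪ψ x • u₀ x, u₂ s x - u₀ x⟫|
      ≤ |∫ x in K, ⟪ψ x • (u₁ s x - u₀ x), u₂ s x⟫| + |∫ x in K, ⟪ψ x • u₀ x, u₂ s x - u₀ x⟫| := abs_add_le _ _
    _ ≤ Cψ * ((∫⁻ x in K, ‖u₁ s x - u₀ x‖ₑ ^ 2) ^ (1 / 2 : ℝ) * (∫⁻ x in K, ‖u₂ s x‖ₑ ^ 2) ^ (1 / 2 : ℝ)).toReal +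
        Cψ * ((∫⁻ x in K, ‖u₀ x‖ₑ ^ 2) ^ (1 / 2 : ℝ) * (∫⁻ x in K, ‖u₂ s x - u₀ x‖ₑ ^ 2) ^ (1 / 2 : ℝ)).toReal :=
        add_le_add hP hR
    _ = Cψ * (((∫⁻ x in K, ‖u₁ s x - u₀ x‖ₑ ^ 2) ^ (1 / 2 : ℝ) * (∫⁻ x in K, ‖u₂ s x‖ₑ ^ 2) ^ (1 / 2 : ℝ)) +
        ((∫⁻ x in K, ‖u₀ x‖ₑ ^ 2) ^ (1 / 2 : ℝ) * (∫⁻ x in K, ‖u₂ s x - u₀ x‖ₑ ^ 2) ^ (1 / 2 : ℝ))).toReal := by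
        rw [ENNReal.toReal_add (ENNReal.mul_ne_top hfinA1 hfinB) (ENNReal.mul_ne_top hfinU0 hfinA2)]
        ring
    _ ≤ Cψ * ((∫⁻ x in K, ‖u₁ s x - u₀ x‖ₑ ^ 2) ^ (1 / 2 : ℝ) * Cb +
        (∫⁻ x in K, ‖u₀ x‖ₑ ^ 2) ^ (1 / 2 : ℝ) * (∫⁻ x in K, ‖u₂ s x - u₀ x‖ₑ ^ 2) ^ (1 / 2 : ℝ)).toReal := by
        refine mul_le_mul_of_nonneg_left (ENNReal.toReal_mono ?_ ?_) hCψ0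
        · exact ENNReal.add_ne_top.2 ⟨ENNReal.mul_ne_top hfinA1 hCb, ENNReal.mul_ne_top hfinU0 hfinA2⟩
        · exact add_le_add (mul_le_mul' le_rfl hb2) le_rfl

/-! ## The identity against the du Bois-Reymond test class -/

/-- A smooth monotone cut-off `ζ_τ(s) = S((s-τ)/τ)` (`S` = `Real.smoothTransition`): `C¹`,
`= 0` on `(-∞, τ]`, `= 1` on `[2τ, ∞)`, values in `[0,1]`, `ζ' ≥ 0`, `ζ' = 0` off `[τ, 2τ]`.
[folklore] -/
theorem cutoff_facts {τ : ℝ} (hτ : 0 < τ) :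
    ContDiff ℝ 1 (fun s => Real.smoothTransition ((s - τ) / τ)) ∧
    (∀ s, s ≤ τ → Real.smoothTransition ((s - τ) / τ) = 0) ∧
    (∀ s, 2 * τ ≤ s → Real.smoothTransition ((s - τ) / τ) = 1) ∧
    (∀ s, 0 ≤ Real.smoothTransition ((s - τ) / τ) ∧ Real.smoothTransition ((s - τ) / τ) ≤ 1) ∧
    (∀ s, 0 ≤ deriv (fun s => Real.smoothTransition ((s - τ) / τ)) s) ∧
    (∀ s, s < τ → deriv (fun s => Real.smoothTransition ((s - τ) / τ)) s = 0) ∧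
    (∀ s, 2 * τ < s → deriv (fun s => Real.smoothTransition ((s - τ) / τ)) s = 0) := by
  have h0 : ∀ s, s ≤ τ → Real.smoothTransition ((s - τ) / τ) = 0 := fun s hs =>
    Real.smoothTransition.zero_of_nonpos (by rw [div_le_iff₀ hτ]; linarith)
  have h1 : ∀ s, 2 * τ ≤ s → Real.smoothTransition ((s - τ) / τ) = 1 := fun s hs =>
    Real.smoothTransition.one_of_one_le (by rw [le_div_iff₀ hτ]; linarith)
  have hmono : Monotone (fun s => Real.smoothTransition ((s - τ) / τ)) :=
    Real.smoothTransition.monotone.comp fun a b hab => by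
      exact div_le_div_of_nonneg_right (sub_le_sub_right hab _) hτ.le
  refine ⟨(Real.smoothTransition.contDiff (n := 1)).comp ((contDiff_id.sub contDiff_const).div_const _),
    h0, h1, fun s => ⟨Real.smoothTransition.nonneg _, Real.smoothTransition.le_one _⟩,
    fun s => hmono.deriv_nonneg, fun s hs => ?_, fun s hs => ?_⟩
  · have : (fun s => Real.smoothTransition ((s - τ) / τ)) =ᶠ[𝓝 s] fun _ => (0 : ℝ) := by
      filter_upwards [Iio_mem_nhds hs] with r hr using h0 r hr.le
    rw [this.deriv_eq, deriv_const]
  · have : (fun s => Real.smoothTransition ((s - τ) / τ)) =ᶠ[𝓝 s] fun _ => (1 : ℝ) := by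
      filter_upwards [Ioi_mem_nhds hs] with r hr using h1 r hr.le
    rw [this.deriv_eq, deriv_const]

set_option maxHeartbeats 1600000 in
/-- **The balance of `u₁ · u₂` against the du Bois-Reymond test class.** For every smooth
compactly supported `η` with `tsupport η ⊆ (-∞, T)`,
`∫_{(0,T)} (η' V + η (f + g)) + η(0) ∫ ψ |u₀|² = 0`
(`cross_distributional` for `η ζ_τ` with the cut-offs `ζ_τ` near `t = 0`, and the initial layer
`cross_initial_layer` as `τ → 0`). [cite: LemarieRieusset2016, Thm. 14.7 proof p. 515] -/
theorem cross_test_identity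
    (h₁ : IsLocalLeraySolutionOn T ν u₀ u₁ p₁) (h₂ : IsLocalLeraySolutionOn T ν u₀ u₂ p₂)
    (hG₁ : HasWeakSpatialGradientOn (slab (EuclideanSpace ℝ (Fin 3)) (Ioo 0 T) isOpen_Ioo) u₁ G₁)
    (hG₂ : HasWeakSpatialGradientOn (slab (EuclideanSpace ℝ (Fin 3)) (Ioo 0 T) isOpen_Ioo) u₂ G₂)
    (hψ : IsTestFunctionOn (⊤ : Opens (EuclideanSpace ℝ (Fin 3))) ψ)
    (hu₃ : AEStronglyMeasurable (uncurry u₃)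
      ((volume : Measure (ℝ × EuclideanSpace ℝ (Fin 3))).restrict (Ioo 0 T ×ˢ univ)))
    (hsplit : uncurry u₁ =ᵐ[(volume : Measure (ℝ × EuclideanSpace ℝ (Fin 3))).restrict (Ioo 0 T ×ˢ univ)]
      fun z => u₃ z.1 z.2 + u₄ z.1 z.2)
    (hm : ∀ᵐ t ∂((volume : Measure ℝ).restrict (Ioo 0 T)), eLpNorm (u₃ t) ∞ volume ≤ ENNReal.ofReal (m t))
    (hm2 : IntegrableOn (fun t => m t ^ 2) (Ioo 0 T) volume)
    (hε : ∀ᵐ t ∂((volume : Measure ℝ).restrict (Ioo 0 T)), eLpNorm (u₄ t) 3 volume ≤ ENNReal.ofReal ε)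
    (hT : 0 < T) (hm₀ : AEStronglyMeasurable u₀ volume)
    (η : ℝ → ℝ) (hη : ContDiff ℝ ((⊤ : ℕ∞) : WithTop ℕ∞) η) (hηK : HasCompactSupport η) (hηT : tsupport η ⊆ Iio T) :
    (∫ s in Ioo 0 T, (deriv η s * (∫ x, ⟪u₁ s x, ψ x • u₂ s x⟫) + η s *
        ((((-∫ x, ⟪G₁ s x (u₁ s x), ψ x • u₂ s x⟫) + ∫ x, p₁ s x * fderiv ℝ ψ x (u₂ s x)) -
          ν * ∫ x, ∑ i, ⟪G₁ s x (stdOrthonormalBasis ℝ (EuclideanSpace ℝ (Fin 3)) i),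
            fderiv ℝ ψ x (stdOrthonormalBasis ℝ (EuclideanSpace ℝ (Fin 3)) i) • u₂ s x + ψ x • G₂ s x (stdOrthonormalBasis ℝ (EuclideanSpace ℝ (Fin 3)) i)⟫) +
         (((-∫ x, ⟪G₂ s x (u₂ s x), ψ x • u₁ s x⟫) + ∫ x, p₂ s x * fderiv ℝ ψ x (u₁ s x)) -
          ν * ∫ x, ∑ i, ⟪G₂ s x (stdOrthonormalBasis ℝ (EuclideanSpace ℝ (Fin 3)) i),
            fderiv ℝ ψ x (stdOrthonormalBasis ℝ (EuclideanSpace ℝ (Fin 3)) i) • u₁ s x + ψ x • G₁ s x (stdOrthonormalBasis ℝ (EuclideanSpace ℝ (Fin 3)) i)⟫)))) + η 0 * (∫ x, ⟪u₀ x, ψ x • u₀ x⟫) = 0 := by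
  set μI : Measure ℝ := volume.restrict (Ioo 0 T) with hμI
  haveI : IsFiniteMeasure μI := by rw [hμI]; exact isFiniteMeasure_restrict.2 measure_Ioo_lt_top.ne
  have hVi : Integrable (fun s => (∫ x, ⟪u₁ s x, ψ x • u₂ s x⟫)) μI := integrable_cross_V h₁ h₂ hψ
  obtain ⟨-, -, hfd, hgd⟩ := integrable_cross_densities h₁ h₂ hG₁ hG₂ hψ hu₃ hsplit hm hm2 hε
  have hFdi : Integrable (fun s => (((-∫ x, ⟪G₁ s x (u₁ s x), ψ x • u₂ s x⟫) + ∫ x, p₁ s x * fderiv ℝ ψ x (u₂ s x)) -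
          ν * ∫ x, ∑ i, ⟪G₁ s x (stdOrthonormalBasis ℝ (EuclideanSpace ℝ (Fin 3)) i),
            fderiv ℝ ψ x (stdOrthonormalBasis ℝ (EuclideanSpace ℝ (Fin 3)) i) • u₂ s x + ψ x • G₂ s x (stdOrthonormalBasis ℝ (EuclideanSpace ℝ (Fin 3)) i)⟫) +
      (((-∫ x, ⟪G₂ s x (u₂ s x), ψ x • u₁ s x⟫) + ∫ x, p₂ s x * fderiv ℝ ψ x (u₁ s x)) -
          ν * ∫ x, ∑ i, ⟪G₂ s x (stdOrthonormalBasis ℝ (EuclideanSpace ℝ (Fin 3)) i),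
            fderiv ℝ ψ x (stdOrthonormalBasis ℝ (EuclideanSpace ℝ (Fin 3)) i) • u₁ s x + ψ x • G₁ s x (stdOrthonormalBasis ℝ (EuclideanSpace ℝ (Fin 3)) i)⟫)) μI := hfd.add hgd
  obtain ⟨T', hT'T, hT'⟩ := exists_lt_forall_eq_zero_of_tsupport_subset_Iio hηK hηT
  have hη1 : ContDiff ℝ 1 η := hη.of_le (by exact_mod_cast le_top)
  have hηc : Continuous η := hη.continuous
  have hη'c : Continuous (deriv η) := hη1.continuous_deriv le_rfl
  obtain ⟨Cη, hCη⟩ := hηc.bounded_above_of_compact_support hηK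
  obtain ⟨Cη', hCη'⟩ := hη'c.bounded_above_of_compact_support hηK.deriv
  have hCη0 : 0 ≤ Cη := (norm_nonneg _).trans (hCη 0)
  rcases le_or_gt T' 0 with hT'0 | hT'0
  · -- `η` vanishes on `[0, ∞)`
    have hz : ∀ s, 0 ≤ s → η s = 0 := fun s hs => hT' s (hT'0.trans hs)
    have hz' : ∀ s, 0 < s → deriv η s = 0 := fun s hs => by
      have : η =ᶠ[𝓝 s] fun _ => (0 : ℝ) := by
        filter_upwards [Ioi_mem_nhds (hT'0.trans_lt hs)] with r hr using hT' r hr.le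
      rw [this.deriv_eq, deriv_const]
    have h0 : ∫ s in Ioo 0 T, (deriv η s * (∫ x, ⟪u₁ s x, ψ x • u₂ s x⟫) + η s *
        ((((-∫ x, ⟪G₁ s x (u₁ s x), ψ x • u₂ s x⟫) + ∫ x, p₁ s x * fderiv ℝ ψ x (u₂ s x)) -
          ν * ∫ x, ∑ i, ⟪G₁ s x (stdOrthonormalBasis ℝ (EuclideanSpace ℝ (Fin 3)) i),
            fderiv ℝ ψ x (stdOrthonormalBasis ℝ (EuclideanSpace ℝ (Fin 3)) i) • u₂ s x + ψ x • G₂ s x (stdOrthonormalBasis ℝ (EuclideanSpace ℝ (Fin 3)) i)⟫) +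
         (((-∫ x, ⟪G₂ s x (u₂ s x), ψ x • u₁ s x⟫) + ∫ x, p₂ s x * fderiv ℝ ψ x (u₁ s x)) -
          ν * ∫ x, ∑ i, ⟪G₂ s x (stdOrthonormalBasis ℝ (EuclideanSpace ℝ (Fin 3)) i),
            fderiv ℝ ψ x (stdOrthonormalBasis ℝ (EuclideanSpace ℝ (Fin 3)) i) • u₁ s x + ψ x • G₁ s x (stdOrthonormalBasis ℝ (EuclideanSpace ℝ (Fin 3)) i)⟫))) = 0 :=
      setIntegral_eq_zero_of_forall_eq_zero fun s hs => by rw [hz s hs.1.le, hz' s hs.1]; ring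
    rw [h0, hz 0 le_rfl]; ring
  -- ### main case: cut-offs near `t = 0`
  set τ : ℕ → ℝ := fun k => T' / 4 * (1 / ((k : ℝ) + 1)) with hτ
  have hτpos : ∀ k, 0 < τ k := fun k => by positivity
  have hτle : ∀ k, τ k ≤ T' / 4 := fun k => by
    have hk : (1 : ℝ) / ((k : ℝ) + 1) ≤ 1 := by
      rw [div_le_one (by positivity)]; linarith [(Nat.cast_nonneg k : (0 : ℝ) ≤ k)]
    calc τ k = T' / 4 * (1 / ((k : ℝ) + 1)) := rfl
      _ ≤ T' / 4 * 1 := mul_le_mul_of_nonneg_left hk (by positivity)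
      _ = T' / 4 := mul_one _
  have hτ0 : Tendsto τ atTop (𝓝 0) := by
    have := tendsto_one_div_add_atTop_nhds_zero_nat.const_mul (T' / 4)
    rw [mul_zero] at this
    exact this
  set ζ : ℕ → ℝ → ℝ := fun k s => Real.smoothTransition ((s - τ k) / τ k) with hζ
  have hZ : ∀ k, ContDiff ℝ 1 (ζ k) ∧ (∀ s, s ≤ τ k → ζ k s = 0) ∧ (∀ s, 2 * τ k ≤ s → ζ k s = 1) ∧
      (∀ s, 0 ≤ ζ k s ∧ ζ k s ≤ 1) ∧ (∀ s, 0 ≤ deriv (ζ k) s) ∧ (∀ s, s < τ k → deriv (ζ k) s = 0) ∧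
      (∀ s, 2 * τ k < s → deriv (ζ k) s = 0) := fun k => cutoff_facts (hτpos k)
  -- the products `η ζ_k`
  have hχ1 : ∀ k, ContDiff ℝ 1 (fun s => η s * ζ k s) := fun k => hη1.mul (hZ k).1
  have hδk : ∀ k, 0 < min (τ k) (T - T') := fun k => lt_min (hτpos k) (by linarith)
  have hχs : ∀ k, tsupport (fun s => η s * ζ k s) ⊆ Icc (min (τ k) (T - T')) (T - min (τ k) (T - T')) := by
    intro k s hs
    by_contra hnot
    rw [mem_Icc, not_and_or, not_le, not_le] at hnot
    have hzero : (fun s => η s * ζ k s) =ᶠ[𝓝 s] 0 := by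
      rcases hnot with h | h
      · have hs' : s < τ k := h.trans_le (min_le_left _ _)
        filter_upwards [Iio_mem_nhds hs'] with r hr
        simp only [Pi.zero_apply]
        rw [(hZ k).2.1 r hr.le, mul_zero]
      · have hs' : T' < s := by have := min_le_right (τ k) (T - T'); linarith
        filter_upwards [Ioi_mem_nhds hs'] with r hr
        simp only [Pi.zero_apply]
        rw [hT' r hr.le, zero_mul]
    exact (notMem_tsupport_iff_eventuallyEq.2 hzero) hs
  have hAk := fun k => cross_distributional h₁ h₂ hG₁ hG₂ hψ hu₃ hsplit hm hm2 hε hT hm₀ (hχ1 k) (hδk k) (hχs k)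
  -- bounds for the cut-offs and their derivatives
  have hζb : ∀ k s, ‖ζ k s‖ ≤ 1 := fun k s => by
    rw [Real.norm_eq_abs, abs_of_nonneg ((hZ k).2.2.2.1 s).1]; exact ((hZ k).2.2.2.1 s).2
  have hζ'c : ∀ k, Continuous (deriv (ζ k)) := fun k => (hZ k).1.continuous_deriv le_rfl
  have hζ'K : ∀ k, HasCompactSupport (deriv (ζ k)) := fun k => by
    refine HasCompactSupport.intro (isCompact_Icc (a := τ k) (b := 2 * τ k)) fun s hs => ?_
    rw [mem_Icc, not_and_or, not_le, not_le] at hs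
    rcases hs with h | h
    · exact (hZ k).2.2.2.2.2.1 s h
    · exact (hZ k).2.2.2.2.2.2 s h
  have hζ'b : ∀ k, ∃ C, ∀ s, ‖deriv (ζ k) s‖ ≤ C := fun k => (hζ'c k).bounded_above_of_compact_support (hζ'K k)
  -- integrability of the three pieces
  have iA : ∀ k, Integrable (fun s => deriv η s * ζ k s * (∫ x, ⟪u₁ s x, ψ x • u₂ s x⟫)) μI := fun k =>
    hVi.bdd_mul (c := Cη' * 1) ((hη'c.mul (hZ k).1.continuous).aestronglyMeasurable)
      (Eventually.of_forall fun s => by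
        rw [norm_mul]; exact mul_le_mul (hCη' s) (hζb k s) (norm_nonneg _) ((norm_nonneg _).trans (hCη' 0)))
  have iB : ∀ k, Integrable (fun s => η s * deriv (ζ k) s * (∫ x, ⟪u₁ s x, ψ x • u₂ s x⟫)) μI := fun k => by
    obtain ⟨C, hC⟩ := hζ'b k
    exact hVi.bdd_mul (c := Cη * C) ((hηc.mul (hζ'c k)).aestronglyMeasurable)
      (Eventually.of_forall fun s => by
        rw [norm_mul]; exact mul_le_mul (hCη s) (hC s) (norm_nonneg _) hCη0)
  have iC : ∀ k, Integrable (fun s => η s * ζ k s * ((((-∫ x, ⟪G₁ s x (u₁ s x), ψ x • u₂ s x⟫) + ∫ x, p₁ s x * fderiv ℝ ψ x (u₂ s x)) -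
          ν * ∫ x, ∑ i, ⟪G₁ s x (stdOrthonormalBasis ℝ (EuclideanSpace ℝ (Fin 3)) i),
            fderiv ℝ ψ x (stdOrthonormalBasis ℝ (EuclideanSpace ℝ (Fin 3)) i) • u₂ s x + ψ x • G₂ s x (stdOrthonormalBasis ℝ (EuclideanSpace ℝ (Fin 3)) i)⟫) +
      (((-∫ x, ⟪G₂ s x (u₂ s x), ψ x • u₁ s x⟫) + ∫ x, p₂ s x * fderiv ℝ ψ x (u₁ s x)) -
          ν * ∫ x, ∑ i, ⟪G₂ s x (stdOrthonormalBasis ℝ (EuclideanSpace ℝ (Fin 3)) i),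
            fderiv ℝ ψ x (stdOrthonormalBasis ℝ (EuclideanSpace ℝ (Fin 3)) i) • u₁ s x + ψ x • G₁ s x (stdOrthonormalBasis ℝ (EuclideanSpace ℝ (Fin 3)) i)⟫))) μI := fun k =>
    hFdi.bdd_mul (c := Cη * 1) ((hηc.mul (hZ k).1.continuous).aestronglyMeasurable)
      (Eventually.of_forall fun s => by
        rw [norm_mul]; exact mul_le_mul (hCη s) (hζb k s) (norm_nonneg _) hCη0)
  have hsum : ∀ k, ((∫ s, deriv η s * ζ k s * (∫ x, ⟪u₁ s x, ψ x • u₂ s x⟫) ∂μI) +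
      ∫ s, η s * deriv (ζ k) s * (∫ x, ⟪u₁ s x, ψ x • u₂ s x⟫) ∂μI) +
      ∫ s, η s * ζ k s * ((((-∫ x, ⟪G₁ s x (u₁ s x), ψ x • u₂ s x⟫) + ∫ x, p₁ s x * fderiv ℝ ψ x (u₂ s x)) -
          ν * ∫ x, ∑ i, ⟪G₁ s x (stdOrthonormalBasis ℝ (EuclideanSpace ℝ (Fin 3)) i),
            fderiv ℝ ψ x (stdOrthonormalBasis ℝ (EuclideanSpace ℝ (Fin 3)) i) • u₂ s x + ψ x • G₂ s x (stdOrthonormalBasis ℝ (EuclideanSpace ℝ (Fin 3)) i)⟫) +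
        (((-∫ x, ⟪G₂ s x (u₂ s x), ψ x • u₁ s x⟫) + ∫ x, p₂ s x * fderiv ℝ ψ x (u₁ s x)) -
          ν * ∫ x, ∑ i, ⟪G₂ s x (stdOrthonormalBasis ℝ (EuclideanSpace ℝ (Fin 3)) i),
            fderiv ℝ ψ x (stdOrthonormalBasis ℝ (EuclideanSpace ℝ (Fin 3)) i) • u₁ s x + ψ x • G₁ s x (stdOrthonormalBasis ℝ (EuclideanSpace ℝ (Fin 3)) i)⟫)) ∂μI = 0 := by
    intro k
    have h := hAk k
    have e1 : ∫ s, deriv (fun s => η s * ζ k s) s * (∫ x, ⟪u₁ s x, ψ x • u₂ s x⟫) ∂μI =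
        ∫ s, (deriv η s * ζ k s * (∫ x, ⟪u₁ s x, ψ x • u₂ s x⟫) +
          η s * deriv (ζ k) s * (∫ x, ⟪u₁ s x, ψ x • u₂ s x⟫)) ∂μI := by
      refine integral_congr_ae (Eventually.of_forall fun s => ?_)
      simp only
      rw [deriv_fun_mul (hη1.differentiable one_ne_zero s) ((hZ k).1.differentiable one_ne_zero s)]
      ring
    rw [e1, integral_add (iA k) (iB k)] at h
    exact h
  -- ### the three limits
  have hζlim : ∀ s, 0 < s → ∀ᶠ k in atTop, ζ k s = 1 := fun s hs => by
    have : ∀ᶠ k in atTop, τ k < s / 2 := (tendsto_order.1 hτ0).2 _ (half_pos hs)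
    filter_upwards [this] with k hk using (hZ k).2.2.1 s (by linarith)
  have L1 : Tendsto (fun k => ∫ s, deriv η s * ζ k s * (∫ x, ⟪u₁ s x, ψ x • u₂ s x⟫) ∂μI) atTop
      (𝓝 (∫ s, deriv η s * (∫ x, ⟪u₁ s x, ψ x • u₂ s x⟫) ∂μI)) := by
    refine tendsto_integral_of_dominated_convergence (fun s => Cη' * ‖(∫ x, ⟪u₁ s x, ψ x • u₂ s x⟫)‖)
      (fun k => (iA k).aestronglyMeasurable) (hVi.norm.const_mul _) (fun k => ?_) ?_
    · refine Eventually.of_forall fun s => ?_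
      rw [norm_mul, norm_mul]
      calc ‖deriv η s‖ * ‖ζ k s‖ * ‖(∫ x, ⟪u₁ s x, ψ x • u₂ s x⟫)‖
          ≤ Cη' * 1 * ‖(∫ x, ⟪u₁ s x, ψ x • u₂ s x⟫)‖ :=
            mul_le_mul_of_nonneg_right (mul_le_mul (hCη' s) (hζb k s) (norm_nonneg _)
              ((norm_nonneg _).trans (hCη' 0))) (norm_nonneg _)
        _ = Cη' * ‖(∫ x, ⟪u₁ s x, ψ x • u₂ s x⟫)‖ := by rw [mul_one]
    · refine (ae_restrict_mem measurableSet_Ioo).mono fun s hs => ?_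
      refine (tendsto_const_nhds (x := deriv η s * (∫ x, ⟪u₁ s x, ψ x • u₂ s x⟫))).congr' ?_
      filter_upwards [hζlim s hs.1] with k hk
      rw [hk, mul_one]
  have L3 : Tendsto (fun k => ∫ s, η s * ζ k s * ((((-∫ x, ⟪G₁ s x (u₁ s x), ψ x • u₂ s x⟫) + ∫ x, p₁ s x * fderiv ℝ ψ x (u₂ s x)) -
          ν * ∫ x, ∑ i, ⟪G₁ s x (stdOrthonormalBasis ℝ (EuclideanSpace ℝ (Fin 3)) i),
            fderiv ℝ ψ x (stdOrthonormalBasis ℝ (EuclideanSpace ℝ (Fin 3)) i) • u₂ s x + ψ x • G₂ s x (stdOrthonormalBasis ℝ (EuclideanSpace ℝ (Fin 3)) i)⟫) +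
        (((-∫ x, ⟪G₂ s x (u₂ s x), ψ x • u₁ s x⟫) + ∫ x, p₂ s x * fderiv ℝ ψ x (u₁ s x)) -
          ν * ∫ x, ∑ i, ⟪G₂ s x (stdOrthonormalBasis ℝ (EuclideanSpace ℝ (Fin 3)) i),
            fderiv ℝ ψ x (stdOrthonormalBasis ℝ (EuclideanSpace ℝ (Fin 3)) i) • u₁ s x + ψ x • G₁ s x (stdOrthonormalBasis ℝ (EuclideanSpace ℝ (Fin 3)) i)⟫)) ∂μI) atTop
      (𝓝 (∫ s, η s * ((((-∫ x, ⟪G₁ s x (u₁ s x), ψ x • u₂ s x⟫) + ∫ x, p₁ s x * fderiv ℝ ψ x (u₂ s x)) -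
          ν * ∫ x, ∑ i, ⟪G₁ s x (stdOrthonormalBasis ℝ (EuclideanSpace ℝ (Fin 3)) i),
            fderiv ℝ ψ x (stdOrthonormalBasis ℝ (EuclideanSpace ℝ (Fin 3)) i) • u₂ s x + ψ x • G₂ s x (stdOrthonormalBasis ℝ (EuclideanSpace ℝ (Fin 3)) i)⟫) +
        (((-∫ x, ⟪G₂ s x (u₂ s x), ψ x • u₁ s x⟫) + ∫ x, p₂ s x * fderiv ℝ ψ x (u₁ s x)) -
          ν * ∫ x, ∑ i, ⟪G₂ s x (stdOrthonormalBasis ℝ (EuclideanSpace ℝ (Fin 3)) i),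
            fderiv ℝ ψ x (stdOrthonormalBasis ℝ (EuclideanSpace ℝ (Fin 3)) i) • u₁ s x + ψ x • G₁ s x (stdOrthonormalBasis ℝ (EuclideanSpace ℝ (Fin 3)) i)⟫)) ∂μI)) := by
    refine tendsto_integral_of_dominated_convergence (fun s => Cη * ‖(((-∫ x, ⟪G₁ s x (u₁ s x), ψ x • u₂ s x⟫) + ∫ x, p₁ s x * fderiv ℝ ψ x (u₂ s x)) -
          ν * ∫ x, ∑ i, ⟪G₁ s x (stdOrthonormalBasis ℝ (EuclideanSpace ℝ (Fin 3)) i),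
            fderiv ℝ ψ x (stdOrthonormalBasis ℝ (EuclideanSpace ℝ (Fin 3)) i) • u₂ s x + ψ x • G₂ s x (stdOrthonormalBasis ℝ (EuclideanSpace ℝ (Fin 3)) i)⟫) +
        (((-∫ x, ⟪G₂ s x (u₂ s x), ψ x • u₁ s x⟫) + ∫ x, p₂ s x * fderiv ℝ ψ x (u₁ s x)) -
          ν * ∫ x, ∑ i, ⟪G₂ s x (stdOrthonormalBasis ℝ (EuclideanSpace ℝ (Fin 3)) i),
            fderiv ℝ ψ x (stdOrthonormalBasis ℝ (EuclideanSpace ℝ (Fin 3)) i) • u₁ s x + ψ x • G₁ s x (stdOrthonormalBasis ℝ (EuclideanSpace ℝ (Fin 3)) i)⟫)‖)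
      (fun k => (iC k).aestronglyMeasurable) (hFdi.norm.const_mul _) (fun k => ?_) ?_
    · refine Eventually.of_forall fun s => ?_
      rw [norm_mul, norm_mul]
      refine mul_le_mul_of_nonneg_right ?_ (norm_nonneg _)
      calc ‖η s‖ * ‖ζ k s‖ ≤ Cη * 1 := mul_le_mul (hCη s) (hζb k s) (norm_nonneg _) hCη0
        _ = Cη := mul_one _
    · refine (ae_restrict_mem measurableSet_Ioo).mono fun s hs => ?_
      refine (tendsto_const_nhds (x := η s * ((((-∫ x, ⟪G₁ s x (u₁ s x), ψ x • u₂ s x⟫) + ∫ x, p₁ s x * fderiv ℝ ψ x (u₂ s x)) -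
          ν * ∫ x, ∑ i, ⟪G₁ s x (stdOrthonormalBasis ℝ (EuclideanSpace ℝ (Fin 3)) i),
            fderiv ℝ ψ x (stdOrthonormalBasis ℝ (EuclideanSpace ℝ (Fin 3)) i) • u₂ s x + ψ x • G₂ s x (stdOrthonormalBasis ℝ (EuclideanSpace ℝ (Fin 3)) i)⟫) +
        (((-∫ x, ⟪G₂ s x (u₂ s x), ψ x • u₁ s x⟫) + ∫ x, p₂ s x * fderiv ℝ ψ x (u₁ s x)) -
          ν * ∫ x, ∑ i, ⟪G₂ s x (stdOrthonormalBasis ℝ (EuclideanSpace ℝ (Fin 3)) i),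
            fderiv ℝ ψ x (stdOrthonormalBasis ℝ (EuclideanSpace ℝ (Fin 3)) i) • u₁ s x + ψ x • G₁ s x (stdOrthonormalBasis ℝ (EuclideanSpace ℝ (Fin 3)) i)⟫)))).congr' ?_
      filter_upwards [hζlim s hs.1] with k hk
      rw [hk, mul_one]
  have L2 : Tendsto (fun k => ∫ s, η s * deriv (ζ k) s * (∫ x, ⟪u₁ s x, ψ x • u₂ s x⟫) ∂μI) atTop
      (𝓝 (η 0 * ∫ x, ⟪u₀ x, ψ x • u₀ x⟫)) := by
    rw [Metric.tendsto_atTop]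
    intro ε' hε'
    set C : ℝ := ∫ x, ⟪u₀ x, ψ x • u₀ x⟫ with hC
    obtain ⟨s₀, hs₀, hlay⟩ := cross_initial_layer h₁ h₂ hψ hT hm₀ (ε₁ := ε' / (4 * (Cη + 1))) (by positivity)
    obtain ⟨s₁, hs₁, hcont⟩ : ∃ s₁ > 0, ∀ s, dist s 0 < s₁ → dist (η s) (η 0) < ε' / (4 * (|C| + 1)) :=
      Metric.continuousAt_iff.1 hηc.continuousAt _ (by positivity)
    obtain ⟨N, hN⟩ := eventually_atTop.1 ((tendsto_order.1 hτ0).2 _ (half_pos (lt_min hs₀ hs₁)))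
    refine ⟨N, fun k hk => ?_⟩
    have hτk : 2 * τ k < min s₀ s₁ := by linarith [hN k hk]
    obtain ⟨Cd, hCd⟩ := hζ'b k
    have hζ'i : Integrable (fun s => deriv (ζ k) s) μI := (hζ'c k).integrableOn_Icc.mono_set Ioo_subset_Icc_self
    have hmass : ∫ s, deriv (ζ k) s ∂μI = 1 := by
      rw [hμI, setIntegral_Ioo_deriv_eq_sub (hZ k).1 hT.le, (hZ k).2.2.1 T (by linarith [hτle k]),
        (hZ k).2.1 0 (hτpos k).le]
      norm_num
    have hI : (∫ s, η s * deriv (ζ k) s * (∫ x, ⟪u₁ s x, ψ x • u₂ s x⟫) ∂μI) - η 0 * C =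
        ∫ s, deriv (ζ k) s * (η s * (∫ x, ⟪u₁ s x, ψ x • u₂ s x⟫) - η 0 * C) ∂μI := by
      have e2 : ∫ s, deriv (ζ k) s * (η s * (∫ x, ⟪u₁ s x, ψ x • u₂ s x⟫) - η 0 * C) ∂μI =
          (∫ s, η s * deriv (ζ k) s * (∫ x, ⟪u₁ s x, ψ x • u₂ s x⟫) ∂μI) - ∫ s, deriv (ζ k) s * (η 0 * C) ∂μI := by
        rw [← integral_sub (iB k) (hζ'i.mul_const _)]
        refine integral_congr_ae (Eventually.of_forall fun s => ?_)
        ring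
      rw [e2, integral_mul_const, hmass, one_mul]
    rw [Real.dist_eq, hI]
    -- the pointwise bound `ζ' |η V - η(0) C| ≤ ζ' ε'/2`
    have hbd : ∀ᵐ s ∂μI, ‖deriv (ζ k) s * (η s * (∫ x, ⟪u₁ s x, ψ x • u₂ s x⟫) - η 0 * C)‖ ≤
        deriv (ζ k) s * (ε' / 2) := by
      filter_upwards [hlay, ae_restrict_mem measurableSet_Ioo] with s hs hsI
      rcases le_or_gt s (2 * τ k) with hs2 | hs2
      · rw [norm_mul, Real.norm_eq_abs, abs_of_nonneg ((hZ k).2.2.2.2.1 s)]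
        refine mul_le_mul_of_nonneg_left ?_ ((hZ k).2.2.2.2.1 s)
        have hss₀ : s < s₀ := by have := min_le_left s₀ s₁; linarith
        have hss₁ : dist s 0 < s₁ := by
          rw [Real.dist_eq, sub_zero, abs_of_pos hsI.1]; have := min_le_right s₀ s₁; linarith
        have h1 := hs hss₀
        have h2 := hcont s hss₁
        rw [Real.dist_eq] at h2
        have hCη1 : ‖η s‖ ≤ Cη := hCη s
        calc ‖η s * (∫ x, ⟪u₁ s x, ψ x • u₂ s x⟫) - η 0 * C‖
            = ‖η s * ((∫ x, ⟪u₁ s x, ψ x • u₂ s x⟫) - C) + (η s - η 0) * C‖ := by ring_nf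
          _ ≤ ‖η s * ((∫ x, ⟪u₁ s x, ψ x • u₂ s x⟫) - C)‖ + ‖(η s - η 0) * C‖ := norm_add_le _ _
          _ = ‖η s‖ * |(∫ x, ⟪u₁ s x, ψ x • u₂ s x⟫) - C| + |η s - η 0| * |C| := by
              rw [norm_mul, norm_mul, Real.norm_eq_abs ((∫ x, ⟪u₁ s x, ψ x • u₂ s x⟫) - C),
                Real.norm_eq_abs (η s - η 0), Real.norm_eq_abs C]
          _ ≤ Cη * (ε' / (4 * (Cη + 1))) + ε' / (4 * (|C| + 1)) * |C| :=
              add_le_add (mul_le_mul hCη1 h1 (abs_nonneg _) hCη0)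
                (mul_le_mul_of_nonneg_right h2.le (abs_nonneg _))
          _ ≤ ε' / 4 + ε' / 4 := by
              refine add_le_add ?_ ?_
              · rw [mul_div_assoc']
                rw [div_le_div_iff₀ (by positivity) (by positivity)]
                nlinarith [abs_nonneg C, hε'.le]
              · rw [div_mul_eq_mul_div, div_le_div_iff₀ (by positivity) (by positivity)]
                nlinarith [abs_nonneg C, hε'.le]
          _ = ε' / 2 := by ring
      · rw [(hZ k).2.2.2.2.2.2 s hs2, zero_mul, norm_zero, zero_mul]
    calc |∫ s, deriv (ζ k) s * (η s * (∫ x, ⟪u₁ s x, ψ x • u₂ s x⟫) - η 0 * C) ∂μI|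
        ≤ ∫ s, ‖deriv (ζ k) s * (η s * (∫ x, ⟪u₁ s x, ψ x • u₂ s x⟫) - η 0 * C)‖ ∂μI := by
          rw [← Real.norm_eq_abs]; exact norm_integral_le_integral_norm _
      _ ≤ ∫ s, deriv (ζ k) s * (ε' / 2) ∂μI :=
          integral_mono_of_nonneg (Eventually.of_forall fun s => norm_nonneg _) (hζ'i.mul_const _) hbd
      _ = ε' / 2 := by rw [integral_mul_const, hmass, one_mul]
      _ < ε' := by linarith
  -- ### conclusion
  have hlim := (L1.add L2).add L3
  have hzero : Tendsto (fun k => ((∫ s, deriv η s * ζ k s * (∫ x, ⟪u₁ s x, ψ x • u₂ s x⟫) ∂μI) +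
      ∫ s, η s * deriv (ζ k) s * (∫ x, ⟪u₁ s x, ψ x • u₂ s x⟫) ∂μI) +
      ∫ s, η s * ζ k s * ((((-∫ x, ⟪G₁ s x (u₁ s x), ψ x • u₂ s x⟫) + ∫ x, p₁ s x * fderiv ℝ ψ x (u₂ s x)) -
          ν * ∫ x, ∑ i, ⟪G₁ s x (stdOrthonormalBasis ℝ (EuclideanSpace ℝ (Fin 3)) i),
            fderiv ℝ ψ x (stdOrthonormalBasis ℝ (EuclideanSpace ℝ (Fin 3)) i) • u₂ s x + ψ x • G₂ s x (stdOrthonormalBasis ℝ (EuclideanSpace ℝ (Fin 3)) i)⟫) +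
        (((-∫ x, ⟪G₂ s x (u₂ s x), ψ x • u₁ s x⟫) + ∫ x, p₂ s x * fderiv ℝ ψ x (u₁ s x)) -
          ν * ∫ x, ∑ i, ⟪G₂ s x (stdOrthonormalBasis ℝ (EuclideanSpace ℝ (Fin 3)) i),
            fderiv ℝ ψ x (stdOrthonormalBasis ℝ (EuclideanSpace ℝ (Fin 3)) i) • u₁ s x + ψ x • G₁ s x (stdOrthonormalBasis ℝ (EuclideanSpace ℝ (Fin 3)) i)⟫)) ∂μI) atTop (𝓝 0) := by
    simp_rw [hsum]; exact tendsto_const_nhds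
  have heq := tendsto_nhds_unique hlim hzero
  have iA0 : Integrable (fun s => deriv η s * (∫ x, ⟪u₁ s x, ψ x • u₂ s x⟫)) μI :=
    hVi.bdd_mul (c := Cη') hη'c.aestronglyMeasurable (Eventually.of_forall hCη')
  have iC0 : Integrable (fun s => η s * ((((-∫ x, ⟪G₁ s x (u₁ s x), ψ x • u₂ s x⟫) + ∫ x, p₁ s x * fderiv ℝ ψ x (u₂ s x)) -
          ν * ∫ x, ∑ i, ⟪G₁ s x (stdOrthonormalBasis ℝ (EuclideanSpace ℝ (Fin 3)) i),
            fderiv ℝ ψ x (stdOrthonormalBasis ℝ (EuclideanSpace ℝ (Fin 3)) i) • u₂ s x + ψ x • G₂ s x (stdOrthonormalBasis ℝ (EuclideanSpace ℝ (Fin 3)) i)⟫) +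
      (((-∫ x, ⟪G₂ s x (u₂ s x), ψ x • u₁ s x⟫) + ∫ x, p₂ s x * fderiv ℝ ψ x (u₁ s x)) -
          ν * ∫ x, ∑ i, ⟪G₂ s x (stdOrthonormalBasis ℝ (EuclideanSpace ℝ (Fin 3)) i),
            fderiv ℝ ψ x (stdOrthonormalBasis ℝ (EuclideanSpace ℝ (Fin 3)) i) • u₁ s x + ψ x • G₁ s x (stdOrthonormalBasis ℝ (EuclideanSpace ℝ (Fin 3)) i)⟫))) μI :=
    hFdi.bdd_mul (c := Cη) hηc.aestronglyMeasurable (Eventually.of_forall hCη)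
  rw [integral_add iA0 iC0]
  linarith

/-- **The cross identity for two local Leray solutions** (the balance of `u₁ · u₂`,
Lemarié-Rieusset 2016, Thm. 14.7, proof p. 515; Serrin 1963, §4): for a.e. `t ∈ (0,T)`,
`∫ ⟪u₁(t), ψ u₂(t)⟫ = ∫ ⟪u₀, ψ u₀⟫ + ∫_{(0,t]} (f(s,s) + g(s,s)) ds`, with the densities of the two
pairing identities `IsLocalLeraySolutionOn.ae_pairing_smul_eq_datum_add` on the diagonal.
[cite: LemarieRieusset2016, Thm. 14.7 proof p. 515] -/
theorem ae_cross_pairing_eq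
    (h₁ : IsLocalLeraySolutionOn T ν u₀ u₁ p₁) (h₂ : IsLocalLeraySolutionOn T ν u₀ u₂ p₂)
    (hG₁ : HasWeakSpatialGradientOn (slab (EuclideanSpace ℝ (Fin 3)) (Ioo 0 T) isOpen_Ioo) u₁ G₁)
    (hG₂ : HasWeakSpatialGradientOn (slab (EuclideanSpace ℝ (Fin 3)) (Ioo 0 T) isOpen_Ioo) u₂ G₂)
    (hψ : IsTestFunctionOn (⊤ : Opens (EuclideanSpace ℝ (Fin 3))) ψ)
    (hu₃ : AEStronglyMeasurable (uncurry u₃)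
      ((volume : Measure (ℝ × EuclideanSpace ℝ (Fin 3))).restrict (Ioo 0 T ×ˢ univ)))
    (hsplit : uncurry u₁ =ᵐ[(volume : Measure (ℝ × EuclideanSpace ℝ (Fin 3))).restrict (Ioo 0 T ×ˢ univ)]
      fun z => u₃ z.1 z.2 + u₄ z.1 z.2)
    (hm : ∀ᵐ t ∂((volume : Measure ℝ).restrict (Ioo 0 T)), eLpNorm (u₃ t) ∞ volume ≤ ENNReal.ofReal (m t))
    (hm2 : IntegrableOn (fun t => m t ^ 2) (Ioo 0 T) volume)
    (hε : ∀ᵐ t ∂((volume : Measure ℝ).restrict (Ioo 0 T)), eLpNorm (u₄ t) 3 volume ≤ ENNReal.ofReal ε)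
    (hT : 0 < T) (hm₀ : AEStronglyMeasurable u₀ volume) :
    ∀ᵐ t ∂((volume : Measure ℝ).restrict (Ioo 0 T)),
      ∫ x, ⟪u₁ t x, ψ x • u₂ t x⟫ = (∫ x, ⟪u₀ x, ψ x • u₀ x⟫) +
        ∫ s in Ioc 0 t, ((((-∫ x, ⟪G₁ s x (u₁ s x), ψ x • u₂ s x⟫) + ∫ x, p₁ s x * fderiv ℝ ψ x (u₂ s x)) -
          ν * ∫ x, ∑ i, ⟪G₁ s x (stdOrthonormalBasis ℝ (EuclideanSpace ℝ (Fin 3)) i),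
            fderiv ℝ ψ x (stdOrthonormalBasis ℝ (EuclideanSpace ℝ (Fin 3)) i) • u₂ s x + ψ x • G₂ s x (stdOrthonormalBasis ℝ (EuclideanSpace ℝ (Fin 3)) i)⟫) +
          (((-∫ x, ⟪G₂ s x (u₂ s x), ψ x • u₁ s x⟫) + ∫ x, p₂ s x * fderiv ℝ ψ x (u₁ s x)) -
          ν * ∫ x, ∑ i, ⟪G₂ s x (stdOrthonormalBasis ℝ (EuclideanSpace ℝ (Fin 3)) i),
            fderiv ℝ ψ x (stdOrthonormalBasis ℝ (EuclideanSpace ℝ (Fin 3)) i) • u₁ s x + ψ x • G₁ s x (stdOrthonormalBasis ℝ (EuclideanSpace ℝ (Fin 3)) i)⟫)) := by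
  obtain ⟨-, -, hfd, hgd⟩ := integrable_cross_densities h₁ h₂ hG₁ hG₂ hψ hu₃ hsplit hm hm2 hε
  exact ae_eq_add_setIntegral_of_forall_test (integrable_cross_V h₁ h₂ hψ) (hfd.add hgd)
    fun η hη hηK hηT => cross_test_identity h₁ h₂ hG₁ hG₂ hψ hu₃ hsplit hm hm2 hε hT hm₀ η hη hηK hηT

end CrossIdentity

end Literature.Analysis.FluidPDE
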